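import Mathlib
import Literature.AlgebraicGeometry.Resolution.ResolutionOfSingularities
import HarnessLib

/-!
# A separated morphism with a dominant section over a dense open is birational (crux `WildQuotients.WildQuotientResolution`, step R2c)

Crux stmt-ResolutionOfSingularities-15640 (`WildQuotientResolution`), line `Sketch`, registered stub
`stub_phaseZeroHighDim`, clause `IsBirational π`. The conditional normal Phase-0 model
(✓`PhaseZeroNormalModel.exists_normalModel_forall_hasNormalSylow`) comes with `πs : Xs → X′`, a dense open
`V ⊆ X′` and a DOMINANT `j : V → Xs` with `j ≫ πs = (V ↪ X′)`. This file proves that this alone makes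
`πs` an isomorphism over `V`, hence birational in the tree's sense (`Resolution.IsBirational`: an
isomorphism over a dense open with dense preimage), as soon as `πs` is SEPARATED and `Xs` REDUCED:

* `isIso_morphismRestrict_of_section` — `j` corestricts to a section `j′` of `πs|_V : πs⁻¹V → V`; a
  section of a separated morphism is a closed immersion (Mathlib `IsClosedImmersion.of_comp`); `j′` is
  dominant (`IsDominant.of_comp_of_isOpenImmersion`), so its closed image is everything; a surjective
  closed immersion into a reduced scheme is an isomorphism (`isIso_of_isClosedImmersion_of_surjective`);
  hence `πs|_V = j′⁻¹` is an isomorphism.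
* `isBirational_of_section` — `IsBirational πs`.

[OURS · crux stmt-ResolutionOfSingularities-15640 · helper toward `stub_phaseZeroHighDim`; folklore,
counted 0; AI-level work, weaker than expert review.]
-/

-- single-problem summit: the doubled namespace component `ResolutionOfSingularities` is forced
set_option linter.dupNamespace false

noncomputable section

universe u

open CategoryTheory CategoryTheory.Limits AlgebraicGeometry TopologicalSpace
open Literature.AlgebraicGeometry.Resolution

namespace Summit.ResolutionOfSingularities.ResolutionOfSingularities.Theorems.WildQuotientResolution.BirationalOfSection

variable {Xs X : Scheme.{u}} (πs : Xs ⟶ X) [IsSeparated πs] [IsReduced Xs] (V : X.Opens)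
  (j : (V : Scheme.{u}) ⟶ Xs) [IsDominant j] (hj : j ≫ πs = V.ι)

include hj

/-- **A separated morphism from a reduced scheme admitting a dominant section over an open `V` is an
isomorphism over `V`.** [folklore] -/
theorem isIso_morphismRestrict_of_section : IsIso (πs ∣_ V) := by
  -- `j` lands in `πs⁻¹ V`; its corestriction `j'`
  have hrange : Set.range j ⊆ Set.range (πs ⁻¹ᵁ V).ι := by
    rintro _ ⟨v, rfl⟩
    rw [Scheme.Opens.range_ι]
    show πs (j v) ∈ V
    rw [← Scheme.Hom.comp_apply, hj, Scheme.Opens.ι_apply]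
    exact v.2
  let j' : (V : Scheme.{u}) ⟶ (πs ⁻¹ᵁ V : Xs.Opens) := IsOpenImmersion.lift (πs ⁻¹ᵁ V).ι j hrange
  have hj' : j' ≫ (πs ⁻¹ᵁ V).ι = j := IsOpenImmersion.lift_fac _ _ _
  -- `j'` is a section of `πs|_V`
  have hsec : j' ≫ (πs ∣_ V) = 𝟙 _ := by
    rw [← cancel_mono V.ι, Category.assoc, morphismRestrict_ι, ← Category.assoc, hj', hj,
      Category.id_comp]
  -- hence a closed immersion (`πs|_V` separated), dominant (as `j` is), so an isomorphism
  haveI : IsClosedImmersion (j' ≫ (πs ∣_ V)) := by rw [hsec]; infer_instance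
  haveI : IsClosedImmersion j' := IsClosedImmersion.of_comp j' (πs ∣_ V)
  haveI : IsDominant (j' ≫ (πs ⁻¹ᵁ V).ι) := by rw [hj']; infer_instance
  haveI : IsDominant j' := IsDominant.of_comp_of_isOpenImmersion j' (πs ⁻¹ᵁ V).ι
  haveI : Surjective j' := ⟨fun y => by
    have hcl : IsClosed (Set.range j') := j'.isClosedEmbedding.isClosed_range
    have hd : Dense (Set.range j') := j'.denseRange
    have : Set.range j' = Set.univ := by rw [← hcl.closure_eq, hd.closure_eq]
    exact (Set.eq_univ_iff_forall.mp this) y⟩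
  haveI : IsIso j' := isIso_of_isClosedImmersion_of_surjective j'
  haveI : IsIso (j' ≫ (πs ∣_ V)) := by rw [hsec]; infer_instance
  exact IsIso.of_isIso_comp_left j' (πs ∣_ V)

/-- **… hence birational** (tree `Resolution.IsBirational`: an isomorphism over the dense open `V`, whose
preimage contains the dense image of `j`), when `V` is dense. [folklore] -/
theorem isBirational_of_section (hV : Dense (V : Set X)) : IsBirational πs := by
  refine ⟨V, hV, ?_, isIso_morphismRestrict_of_section πs V j hj⟩
  have hsub : Set.range j ⊆ ((πs ⁻¹ᵁ V : Xs.Opens) : Set Xs) := by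
    rintro _ ⟨v, rfl⟩
    show πs (j v) ∈ V
    rw [← Scheme.Hom.comp_apply, hj, Scheme.Opens.ι_apply]
    exact v.2
  exact j.denseRange.mono hsub

end Summit.ResolutionOfSingularities.ResolutionOfSingularities.Theorems.WildQuotientResolution.BirationalOfSection

end
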